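import Summits.AnomalousDissipation.AnomalousDissipation.Theorems.CubicParityLoud.Negative.EnergyRow
import Summits.AnomalousDissipation.AnomalousDissipation.Theorems.QuarticGate.Negative.LevelCeiling
import Summits.AnomalousDissipation.AnomalousDissipation.Theorems.MomentParityMomentClosure

/-!
# `MomentParity.ResolvedDissipation` (stmt-AnomalousDissipation-14284), line `enstrophy-ui-transfer`:
# stub `stub_smoothCylRow` — smooth cylindrical rows of admissible laws

Support file (`--supports stmt-AnomalousDissipation-14284`). For an ADMISSIBLE law `μ` on
`H = L²_σ(T³)` — probability, carried by level-`N` fields (`IsLevel N u`), supported in `‖u‖ ≤ R`,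
stationary for Galerkin NS at `(ν, f)` against every POLYNOMIAL cylindrical observable with level-`N`
band tests (`∀ d, IsPolyStationary ν f N d μ`) — and every `Ψ : ℝ × ℝ → ℝ` of class `C¹` on an open
`U ⊇ [0,∞)²`, the generator row of `u ↦ Ψ(‖P_N u‖², Z_N u)`, `Z_N u = 4π² Σ_{|k| ≤ N} |k|² ‖û(k)‖²`,
is integrable with zero mean (`stub_smoothCylRow`, the registered signature of the lead's skeleton):
`∫ [2 ∂₁Ψ(‖u‖², Z_N u) ⟨F(u), P_N u⟩ + 2 ∂₂Ψ(‖u‖², Z_N u) ⟨F(u), A P_N u⟩] dμ = 0`.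

Proof (FMRT 2001, Ch. IV §1.2, cylindrical test functionals `Φ(u) = φ((u,g₁),…,(u,g_m))`).
1. FRAME: the Galerkin frame of level `N` (`CubicParityLoud.Negative.frameG`, band tests by
   `isBandTest_frameG`); frame identities `Σ_p (u,g_p) g_p = P_N u` (Literature) and, proved here,
   `Σ_p 4π²|k_p|² (u,g_p) g_p = A P_N u`, `Σ_p 4π²|k_p|² (u,g_p)² = Z_N u`.
2. PROFILE: `φ(ξ) = χ(‖ξ‖²/(R²+1)) Ψ(‖ξ‖², G ξ)`, `G = Σ_p 4π²|k_p|² X_p²`, `χ = Torus.galerkinCutoff`: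
   `C¹` (`(‖ξ‖², G ξ) ∈ [0,∞)² ⊆ U`) with compact support — a `Torus.CylindricalTest`.
3. UPGRADE: all-degree polynomial stationarity + `C¹` Weierstrass on the compact level ball
   (`MomentParityMomentClosure.integral_nsGeneratorPairing_grad_eq_zero`): `∫ ⟨F(u), Φ'(u)⟩ dμ = 0`.
4. IDENTIFICATION a.e.: on the carrier `‖coords u‖² = ‖u‖² < R² + 1`, the cutoff is locally `1`, the
   chain rule gives `∂_pφ = 2ξ_p ∂₁Ψ + 8π²|k_p|²ξ_p ∂₂Ψ` at `(‖u‖², Z_N u)`, so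
   `Φ'(u) = 2∂₁Ψ P_N u + 2∂₂Ψ A P_N u`, and `⟨F(u), ·⟩` is linear (`Torus.nsGeneratorPairing_sum_smul`).

`IsLevel/IsBandTest/polyGrad/IsPolyStationary` are the `QuarticGate.Negative` clauses, definitionally
the `CubicParityLoud.Negative` copies used by `MomentParityMomentClosure`. No new definitions.
Reference: Foias–Manley–Rosa–Temam, *Navier–Stokes Equations and Turbulence* (2001), Ch. IV §1.2
(Def. 1.2, example after (1.27)), Ch. V App. B. [FMRT2001]
-/

noncomputable section

-- `Summit.<Summit>.<Problem>`: single-conjunct summit, the duplicate namespace segment is mandated.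
set_option linter.dupNamespace false

namespace Summit.AnomalousDissipation.AnomalousDissipation.Theorems.MomentParityResolvedDissipation.CylRow

open MeasureTheory Filter Topology
open scoped ENNReal InnerProductSpace RealInnerProductSpace
open Literature.Analysis.FunctionSpaces Literature.Analysis.FluidPDE
open Summit.AnomalousDissipation.AnomalousDissipation.Theses.MomentParity
open Summit.AnomalousDissipation.AnomalousDissipation.Theorems.CubicParityLoud.Negative (T3 R3 H3 L2T3)
open Summit.AnomalousDissipation.AnomalousDissipation.Theorems.QuarticGate.Negative
  (IsLevel IsBandTest polyGrad IsPolyStationary)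
open Summit.AnomalousDissipation.AnomalousDissipation.Theorems.CubicParityLoud.Negative
  (frameG isBandTest_frameG fourierTruncate_ae_eq_of_isLevel)

/-- The Galerkin cylindrical test functional of level `N` (Literature), source of the frame. -/
local notation "GT[" N "]" => (Torus.galerkinTest (d := Fin 3) N one_pos)

/-- The frame index `(k, j, c)` (frequency, direction, phase) of the `i`-th frame field of level `N`. -/
local notation "idx[" N "," i "]" => (Equiv.symm (Fintype.equivFin (Torus.FrameIdx (Fin 3) N)) i)

/-- The Stokes weight `4π²|k_i|²` of the `i`-th frame field of level `N`. -/
local notation "wt[" N "," i "]" =>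
  (4 * Real.pi ^ 2 * Torus.freqNormSq (Subtype.val (Prod.fst idx[N,i]) : Fin 3 → ℤ))

/-! ## Frame sums -/

/-- Sums over the `Fin`-indexed Galerkin frame of level `N` are sums over frequencies `0 < |k| ≤ N`,
directions `j` and phases `c`. [folklore] -/
theorem sum_frame_eq {M : Type*} [AddCommMonoid M] (N : ℕ) (F : (Fin 3 → ℤ) → Fin 3 → Bool → M) :
    ∑ i : Fin GT[N].m, F ((idx[N,i]).1 : Fin 3 → ℤ) (idx[N,i]).2.1 (idx[N,i]).2.2 =
      ∑ k ∈ Torus.freqBall₀ N, ∑ j : Fin 3, ∑ c : Bool, F k j c := by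
  have h1 : ∑ i : Fin GT[N].m, F ((idx[N,i]).1 : Fin 3 → ℤ) (idx[N,i]).2.1 (idx[N,i]).2.2 =
      ∑ p : Torus.FrameIdx (Fin 3) N, F (p.1 : Fin 3 → ℤ) p.2.1 p.2.2 :=
    Fintype.sum_equiv (Fintype.equivFin (Torus.FrameIdx (Fin 3) N)).symm _ _ fun _ => rfl
  rw [h1, Fintype.sum_prod_type, ← Finset.sum_coe_sort (Torus.freqBall₀ N)]
  refine Finset.sum_congr rfl fun k _ => ?_
  rw [Fintype.sum_prod_type]

/-- **The frame reproduces the truncation**: `Σ_i (u, g_i) g_i = P_N u` for `u ∈ H`. [folklore] -/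
theorem sum_pairing_smul_frameG (N : ℕ) (u : H3) (x : T3) :
    ∑ i : Fin GT[N].m, Torus.pairing u.1 (frameG N i) • frameG N i x =
      Torus.fourierTruncate N (u.1 : T3 → R3) x := by
  have h := Torus.sum_galerkinTest_eq (d := Fin 3) N one_pos (fun g => Torus.pairing u.1 g • g x)
  exact h.trans (Torus.sum_integral_inner_frameField_smul u.2 N x)

/-- **The weighted frame synthesises `A P_N u = -ΔP_N u`**:
`Σ_i 4π²|k_i|² (u, g_i) g_i = Σ_{|k| ≤ N} Re (e_k · 4π²|k|² û(k))` for `u ∈ H`. [folklore] -/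
theorem sum_wt_pairing_smul_frameG (N : ℕ) (u : H3) (x : T3) :
    ∑ i : Fin GT[N].m, (wt[N,i] * Torus.pairing u.1 (frameG N i)) • frameG N i x =
      Torus.realTrigPoly (Torus.freqBall N) (fun k =>
        (((4 * Real.pi ^ 2 * Torus.freqNormSq k : ℝ)) : ℂ) •
          UnitAddTorus.mFourierCoeff (EuclideanSpace.complexify ∘ (u.1 : T3 → R3)) k) x := by
  have hint : Integrable (u.1 : T3 → R3) volume := (Lp.memLp u.1).integrable one_le_two
  have hdiv := Torus.isWeaklyDivFree_of_mem_energySpace u.2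
  have h1 : ∑ i : Fin GT[N].m, (wt[N,i] * Torus.pairing u.1 (frameG N i)) • frameG N i x =
      ∑ k ∈ Torus.freqBall₀ N, ∑ j : Fin 3, ∑ c : Bool,
        (4 * Real.pi ^ 2 * Torus.freqNormSq k * Torus.pairing u.1 (Torus.frameField k j c)) •
          Torus.frameField k j c x :=
    sum_frame_eq N (fun k j c =>
      (4 * Real.pi ^ 2 * Torus.freqNormSq k * Torus.pairing u.1 (Torus.frameField k j c)) •
        Torus.frameField k j c x)
  rw [h1]
  have key : ∀ k ∈ Torus.freqBall₀ N, ∑ j : Fin 3, ∑ c : Bool,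
      (4 * Real.pi ^ 2 * Torus.freqNormSq k * Torus.pairing u.1 (Torus.frameField k j c)) •
        Torus.frameField k j c x =
      EuclideanSpace.realPart (UnitAddTorus.mFourier k x •
        ((((4 * Real.pi ^ 2 * Torus.freqNormSq k : ℝ)) : ℂ) •
          UnitAddTorus.mFourierCoeff (EuclideanSpace.complexify ∘ (u.1 : T3 → R3)) k)) := by
    intro k _
    simp_rw [mul_smul (4 * Real.pi ^ 2 * Torus.freqNormSq k), ← Finset.smul_sum]
    simp_rw [Torus.pairing, Torus.frameField, Torus.integral_inner_realTrigPoly_singleton hint,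
      Torus.realTrigPoly_singleton_apply, Torus.smul_realPart_mFourier_smul, ← map_sum,
      ← Finset.smul_sum]
    rw [Torus.sum_sum_re_inner_frameVec_smul (hdiv.sum_mul_mFourierCoeff_eq_zero (Lp.memLp _) k),
      Torus.smul_realPart_mFourier_smul]
  rw [Finset.sum_congr rfl key, Torus.freqBall₀, Finset.sum_erase _ (by
      rw [Torus.mFourierCoeff_complexify_coe_zero_of_mem u.2, smul_zero, smul_zero, map_zero]),
    Torus.realTrigPoly_apply_eq_sum]

/-- **Weighted Parseval**: `Σ_i 4π²|k_i|² (u, g_i)² = Z_N u = 4π² Σ_{|k| ≤ N} |k|² ‖û(k)‖²`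
for `u ∈ H`. [folklore] -/
theorem sum_wt_mul_pairing_sq (N : ℕ) (u : H3) :
    ∑ i : Fin GT[N].m, wt[N,i] * Torus.pairing u.1 (frameG N i) ^ 2 =
      4 * Real.pi ^ 2 * ∑ k ∈ Torus.freqBall N, Torus.freqNormSq k *
        ‖UnitAddTorus.mFourierCoeff (EuclideanSpace.complexify ∘ (u.1 : T3 → R3)) k‖ ^ 2 := by
  have hint : Integrable (u.1 : T3 → R3) volume := (Lp.memLp u.1).integrable one_le_two
  have hdiv := Torus.isWeaklyDivFree_of_mem_energySpace u.2
  have h1 : ∑ i : Fin GT[N].m, wt[N,i] * Torus.pairing u.1 (frameG N i) ^ 2 =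
      ∑ k ∈ Torus.freqBall₀ N, ∑ j : Fin 3, ∑ c : Bool,
        4 * Real.pi ^ 2 * Torus.freqNormSq k * Torus.pairing u.1 (Torus.frameField k j c) ^ 2 :=
    sum_frame_eq N (fun k j c =>
      4 * Real.pi ^ 2 * Torus.freqNormSq k * Torus.pairing u.1 (Torus.frameField k j c) ^ 2)
  rw [h1]
  have key : ∀ k ∈ Torus.freqBall₀ N, ∑ j : Fin 3, ∑ c : Bool,
      4 * Real.pi ^ 2 * Torus.freqNormSq k * Torus.pairing u.1 (Torus.frameField k j c) ^ 2 =
      4 * Real.pi ^ 2 * (Torus.freqNormSq k *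
        ‖UnitAddTorus.mFourierCoeff (EuclideanSpace.complexify ∘ (u.1 : T3 → R3)) k‖ ^ 2) := by
    intro k _
    simp_rw [← Finset.mul_sum]
    rw [mul_assoc]
    congr 2
    simp_rw [Torus.pairing, Torus.frameField, Torus.integral_inner_realTrigPoly_singleton hint]
    exact Torus.sum_sum_sq_re_inner_frameVec (hdiv.sum_mul_mFourierCoeff_eq_zero (Lp.memLp _) k)
  rw [Finset.sum_congr rfl key, Torus.freqBall₀, Finset.sum_erase _ (by
      rw [Torus.freqNormSq_zero, zero_mul, mul_zero]), Finset.mul_sum]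

/-- On a level-`N` field the truncation carries the whole energy: `∫ ‖P_N u‖² = ‖u‖²`. [folklore] -/
theorem integral_norm_sq_fourierTruncate_of_isLevel {N : ℕ} {u : H3} (hu : IsLevel N u) :
    ∫ x, ‖Torus.fourierTruncate N (u.1 : T3 → R3) x‖ ^ 2 = ‖u‖ ^ 2 := by
  have h : ‖u‖ = ‖(u.1 : L2T3)‖ := rfl
  rw [h, ← Torus.integral_norm_sq_coe_eq]
  exact integral_congr_ae ((fourierTruncate_ae_eq_of_isLevel hu).mono fun x hx => by simp [hx])

/-! ## Calculus of the profile `χ(‖ξ‖²/a) Ψ(‖ξ‖², G ξ)` -/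

/-- The cut-off product `ξ ↦ χ(‖ξ‖²/a) F(ξ)` is `C¹` when `F` is (`χ = Torus.galerkinCutoff`). [folklore] -/
theorem contDiff_cutoff_mul {m : ℕ} (a : ℝ) {F : EuclideanSpace ℝ (Fin m) → ℝ} (hF : ContDiff ℝ 1 F) :
    ContDiff ℝ 1 (fun ξ => (Torus.galerkinCutoff : ℝ → ℝ) (‖ξ‖ ^ 2 / a) * F ξ) :=
  ((Torus.galerkinCutoff.contDiff (n := 1)).comp ((contDiff_norm_sq ℝ).div_const a)).mul hF

/-- The cut-off product `ξ ↦ χ(‖ξ‖²/a) F(ξ)` has compact support (`a > 0`): it vanishes for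
`‖ξ‖² ≥ 2a`. [folklore] -/
theorem hasCompactSupport_cutoff_mul {m : ℕ} {a : ℝ} (ha : 0 < a) (F : EuclideanSpace ℝ (Fin m) → ℝ) :
    HasCompactSupport (fun ξ => (Torus.galerkinCutoff : ℝ → ℝ) (‖ξ‖ ^ 2 / a) * F ξ) := by
  refine HasCompactSupport.intro (isCompact_closedBall (0 : EuclideanSpace ℝ (Fin m))
    (Real.sqrt (2 * a))) fun ξ hξ => ?_
  rw [Metric.mem_closedBall, dist_zero_right, not_le] at hξ
  have h2 : 2 * a < ‖ξ‖ ^ 2 := (Real.sqrt_lt' ((Real.sqrt_nonneg _).trans_lt hξ)).1 hξ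
  have h3 : Torus.galerkinCutoff.rOut ≤ dist (‖ξ‖ ^ 2 / a) 0 := by
    rw [Real.dist_eq, sub_zero, abs_of_nonneg (by positivity),
      show Torus.galerkinCutoff.rOut = (2 : ℝ) from rfl, le_div_iff₀ ha]
    linarith
  change (Torus.galerkinCutoff : ℝ → ℝ) (‖ξ‖ ^ 2 / a) * F ξ = 0
  rw [Torus.galerkinCutoff.zero_of_le_dist h3, zero_mul]

/-- Inside the ball `‖ξ‖² < a` the cut-off factor is locally `1`, so the derivative of
`χ(‖ξ‖²/a) F(ξ)` is the derivative of `F`. [folklore] -/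
theorem fderiv_cutoff_mul_eq {m : ℕ} {a : ℝ} (ha : 0 < a) (F : EuclideanSpace ℝ (Fin m) → ℝ)
    {ξ : EuclideanSpace ℝ (Fin m)} (hξ : ‖ξ‖ ^ 2 < a) :
    fderiv ℝ (fun η => (Torus.galerkinCutoff : ℝ → ℝ) (‖η‖ ^ 2 / a) * F η) ξ = fderiv ℝ F ξ := by
  have hball : ‖ξ‖ ^ 2 / a ∈ Metric.ball (0 : ℝ) Torus.galerkinCutoff.rIn := by
    rw [Metric.mem_ball, Real.dist_eq, sub_zero, abs_of_nonneg (by positivity),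
      show Torus.galerkinCutoff.rIn = (1 : ℝ) from rfl, div_lt_one ha]
    exact hξ
  have hcut : ∀ᶠ η in 𝓝 ξ, (Torus.galerkinCutoff : ℝ → ℝ) (‖η‖ ^ 2 / a) = (1 : ℝ → ℝ) (‖η‖ ^ 2 / a) :=
    ((continuous_norm.pow 2).div_const a).continuousAt.eventually
      (Torus.galerkinCutoff.eventuallyEq_one_of_mem_ball hball)
  refine Filter.EventuallyEq.fderiv_eq ?_
  filter_upwards [hcut] with η hη
  rw [hη, Pi.one_apply, one_mul]

/-- **Chain rule through a pair of scalar coordinates**: for `e, G` differentiable at `ξ` and `Ψ`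
differentiable at `(e ξ, G ξ)`, `D(Ψ(e, G))(ξ) v = De(ξ)v · DΨ(1,0) + DG(ξ)v · DΨ(0,1)`. [folklore] -/
theorem fderiv_comp_pair_apply {E : Type*} [NormedAddCommGroup E] [NormedSpace ℝ E]
    {e G : E → ℝ} {Ψ : ℝ × ℝ → ℝ} {ξ : E} (he : DifferentiableAt ℝ e ξ)
    (hG : DifferentiableAt ℝ G ξ) (hΨ : DifferentiableAt ℝ Ψ (e ξ, G ξ)) (v : E) :
    fderiv ℝ (fun η => Ψ (e η, G η)) ξ v =
      fderiv ℝ e ξ v * fderiv ℝ Ψ (e ξ, G ξ) (1, 0) +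
        fderiv ℝ G ξ v * fderiv ℝ Ψ (e ξ, G ξ) (0, 1) := by
  have h := hΨ.hasFDerivAt.comp ξ (he.hasFDerivAt.prodMk hG.hasFDerivAt)
  rw [show (fun η => Ψ (e η, G η)) = Ψ ∘ fun η => (e η, G η) from rfl, h.fderiv,
    ContinuousLinearMap.comp_apply, ContinuousLinearMap.prod_apply]
  have hv : (fderiv ℝ e ξ v, fderiv ℝ G ξ v) =
      (fderiv ℝ e ξ v) • ((1 : ℝ), (0 : ℝ)) + (fderiv ℝ G ξ v) • ((0 : ℝ), (1 : ℝ)) := by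
    ext <;> simp
  rw [hv, map_add, map_smul, map_smul, smul_eq_mul, smul_eq_mul]

/-- `∂ᵢ ‖ξ‖² = 2 ξᵢ` on `ℝᵐ`. [folklore] -/
theorem fderiv_norm_sq_single {m : ℕ} (ξ : EuclideanSpace ℝ (Fin m)) (i : Fin m) :
    fderiv ℝ (fun η : EuclideanSpace ℝ (Fin m) => ‖η‖ ^ 2) ξ (EuclideanSpace.single i 1) = 2 * ξ i := by
  rw [(hasStrictFDerivAt_norm_sq ξ).hasFDerivAt.fderiv]
  simp [innerSL_apply_apply, EuclideanSpace.inner_single_right]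

/-- The enstrophy polynomial `G = Σ_i 4π²|k_i|² X_i²` in the frame coordinates of level `N`. -/
local notation "PG[" N "]" =>
  (∑ i : Fin (Torus.CylindricalTest.m GT[N]), MvPolynomial.C wt[N,i] * MvPolynomial.X i ^ 2)

/-- `G(v) = Σ_i 4π²|k_i|² v_i²`. [folklore] -/
theorem eval_PG (N : ℕ) (v : Fin GT[N].m → ℝ) :
    MvPolynomial.eval v PG[N] = ∑ i : Fin GT[N].m, wt[N,i] * v i ^ 2 := by
  simp only [map_sum, map_mul, MvPolynomial.eval_C, map_pow, MvPolynomial.eval_X]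

/-- `∂ᵢ G(v) = 2 · 4π²|k_i|² v_i`. [folklore] -/
theorem eval_pderiv_PG (N : ℕ) (v : Fin GT[N].m → ℝ) (i : Fin GT[N].m) :
    MvPolynomial.eval v (MvPolynomial.pderiv i PG[N]) = 2 * wt[N,i] * v i := by
  simp [map_sum, Pi.single_apply, Finset.sum_ite_eq', MvPolynomial.eval_C]
  ring

/-! ## The cylindrical test functional of the row -/

/-- The truncation `P_N u` of (the representative of) `u ∈ H`. -/
local notation "Pn[" N "," u "]" => (Torus.fourierTruncate N ((Subtype.val u : L2T3) : T3 → R3))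

/-- The band enstrophy `Z_N u = 4π² Σ_{|k| ≤ N} |k|² ‖û(k)‖²` of `u ∈ H`. -/
local notation "Zr[" N "," u "]" => (4 * Real.pi ^ 2 * ∑ k ∈ Torus.freqBall N, Torus.freqNormSq k *
  ‖UnitAddTorus.mFourierCoeff (EuclideanSpace.complexify ∘ ((Subtype.val u : L2T3) : T3 → R3)) k‖ ^ 2)

/-- The field `A P_N u = -ΔP_N u = Σ_{|k| ≤ N} Re (e_k · 4π²|k|² û(k))` of `u ∈ H`. -/
local notation "Lap[" N "," u "]" => (Torus.realTrigPoly (Torus.freqBall N) fun k =>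
  (((4 * Real.pi ^ 2 * Torus.freqNormSq k : ℝ)) : ℂ) •
    UnitAddTorus.mFourierCoeff (EuclideanSpace.complexify ∘ ((Subtype.val u : L2T3) : T3 → R3)) k)

/-- **The cylindrical test functional of the row.** For `Ψ` of class `C¹` on an open `U ⊇ [0,∞)²`,
a level `N` and a radius `R` there is a cylindrical test functional `Φ` (FMRT's class `𝒯`) whose
fields are level-`N` band tests (the Galerkin frame of level `N`) and whose differential on the
carrier `{IsLevel N u, ‖u‖ ≤ R}` is `Φ'(u) = 2∂₁Ψ(‖u‖², Z_N u) P_N u + 2∂₂Ψ(‖u‖², Z_N u) A P_N u`: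
profile `φ(ξ) = χ(‖ξ‖²/(R²+1)) Ψ(‖ξ‖², Σ_i 4π²|k_i|² ξ_i²)`.
[cite: FMRT2001, Ch. IV §1.2 Def. 1.2 and the example after (1.27)] -/
theorem exists_cylindricalTest (N : ℕ) (R : ℝ) {U : Set (ℝ × ℝ)} {Ψ : ℝ × ℝ → ℝ} (hU : IsOpen U)
    (hsub : Set.Ici (0 : ℝ) ×ˢ Set.Ici (0 : ℝ) ⊆ U) (hΨ : ContDiffOn ℝ 1 Ψ U) :
    ∃ Φ : Torus.CylindricalTest (Fin 3), (∀ i, IsBandTest N (Φ.g i)) ∧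
      ∀ u : H3, IsLevel N u → ‖u‖ ≤ R → Φ.grad u = fun x =>
        (2 * fderiv ℝ Ψ (‖u‖ ^ 2, Zr[N,u]) (1, 0)) • Pn[N,u] x +
          (2 * fderiv ℝ Ψ (‖u‖ ^ 2, Zr[N,u]) (0, 1)) • Lap[N,u] x := by
  have ha : (0 : ℝ) < R ^ 2 + 1 := by positivity
  -- the pair `(‖ξ‖², G ξ)` ranges in the quadrant, where `Ψ` is `C¹`
  have hQU : ∀ ξ : EuclideanSpace ℝ (Fin GT[N].m),
      (‖ξ‖ ^ 2, MvPolynomial.eval (WithLp.ofLp ξ) PG[N]) ∈ U := fun ξ =>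
    hsub (Set.mk_mem_prod (Set.mem_Ici.2 (sq_nonneg _)) (Set.mem_Ici.2 (by
      rw [eval_PG]
      exact Finset.sum_nonneg fun i _ =>
        mul_nonneg (mul_nonneg (by positivity) (Torus.freqNormSq_nonneg _)) (sq_nonneg _))))
  have hΨQ : ContDiff ℝ 1 (fun ξ : EuclideanSpace ℝ (Fin GT[N].m) =>
      Ψ (‖ξ‖ ^ 2, MvPolynomial.eval (WithLp.ofLp ξ) PG[N])) :=
    hΨ.comp_contDiff ((contDiff_norm_sq ℝ).prodMk
      (Literature.Topology.FourManifolds.contDiff_mvPolynomial_eval_ofLp _)) hQU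
  refine ⟨{ m := GT[N].m
            g := frameG N
            g_smooth := GT[N].g_smooth
            g_divFree := GT[N].g_divFree
            g_zeroMean := GT[N].g_zeroMean
            φ := fun ξ => (Torus.galerkinCutoff : ℝ → ℝ) (‖ξ‖ ^ 2 / (R ^ 2 + 1)) *
              Ψ (‖ξ‖ ^ 2, MvPolynomial.eval (WithLp.ofLp ξ) PG[N])
            φ_contDiff := contDiff_cutoff_mul (R ^ 2 + 1) hΨQ
            φ_compact := hasCompactSupport_cutoff_mul ha _ }, fun i => isBandTest_frameG N i,
    fun u hu huR => ?_⟩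
  -- on the carrier: the coordinates, their energy and their enstrophy
  have hξi (i : Fin GT[N].m) : WithLp.ofLp (GT[N].coords u) i = Torus.pairing u.1 (frameG N i) := rfl
  have he : ‖GT[N].coords u‖ ^ 2 = ‖u‖ ^ 2 := by
    rw [Torus.norm_sq_galerkinTest_coords, integral_norm_sq_fourierTruncate_of_isLevel hu]
  have hG : MvPolynomial.eval (WithLp.ofLp (GT[N].coords u)) PG[N] = Zr[N,u] := by
    rw [eval_PG]; exact sum_wt_mul_pairing_sq N u
  have hlt : ‖GT[N].coords u‖ ^ 2 < R ^ 2 + 1 := by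
    rw [he]; linarith [pow_le_pow_left₀ (norm_nonneg u) huR 2]
  -- the partial derivatives of the profile at the coordinates
  have hderiv : ∀ i : Fin GT[N].m,
      fderiv ℝ (fun η : EuclideanSpace ℝ (Fin GT[N].m) =>
          (Torus.galerkinCutoff : ℝ → ℝ) (‖η‖ ^ 2 / (R ^ 2 + 1)) *
            Ψ (‖η‖ ^ 2, MvPolynomial.eval (WithLp.ofLp η) PG[N])) (GT[N].coords u)
          (EuclideanSpace.single i 1) =
        2 * fderiv ℝ Ψ (‖u‖ ^ 2, Zr[N,u]) (1, 0) * Torus.pairing u.1 (frameG N i) +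
          2 * fderiv ℝ Ψ (‖u‖ ^ 2, Zr[N,u]) (0, 1) * (wt[N,i] * Torus.pairing u.1 (frameG N i)) := by
    intro i
    have hed : DifferentiableAt ℝ (fun η : EuclideanSpace ℝ (Fin GT[N].m) => ‖η‖ ^ 2)
        (GT[N].coords u) := (hasStrictFDerivAt_norm_sq _).hasFDerivAt.differentiableAt
    have hGd : DifferentiableAt ℝ (fun η : EuclideanSpace ℝ (Fin GT[N].m) =>
        MvPolynomial.eval (WithLp.ofLp η) PG[N]) (GT[N].coords u) :=
      (Literature.Topology.FourManifolds.hasFDerivAt_mvPolynomial_eval_ofLp _ _).differentiableAt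
    have hΨd : DifferentiableAt ℝ Ψ
        (‖GT[N].coords u‖ ^ 2, MvPolynomial.eval (WithLp.ofLp (GT[N].coords u)) PG[N]) :=
      (hΨ.differentiableOn one_ne_zero).differentiableAt (hU.mem_nhds (hQU _))
    rw [fderiv_cutoff_mul_eq ha _ hlt, fderiv_comp_pair_apply hed hGd hΨd, fderiv_norm_sq_single,
      Literature.Topology.FourManifolds.fderiv_mvPolynomial_eval_ofLp_single, eval_pderiv_PG, he, hG,
      hξi i]
    ring
  -- assemble the differential with the frame identities
  funext x
  change ∑ i : Fin GT[N].m, fderiv ℝ (fun η : EuclideanSpace ℝ (Fin GT[N].m) =>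
      (Torus.galerkinCutoff : ℝ → ℝ) (‖η‖ ^ 2 / (R ^ 2 + 1)) *
        Ψ (‖η‖ ^ 2, MvPolynomial.eval (WithLp.ofLp η) PG[N])) (GT[N].coords u)
      (EuclideanSpace.single i 1) • frameG N i x = _
  simp_rw [hderiv]
  rw [← sum_pairing_smul_frameG N u x, ← sum_wt_pairing_smul_frameG N u x, Finset.smul_sum,
    Finset.smul_sum, ← Finset.sum_add_distrib]
  refine Finset.sum_congr rfl fun i _ => ?_
  rw [add_smul, smul_smul, smul_smul]

/-! ## The row -/

/-- Linearity of the tested generator in two smooth test fields: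
`⟨F(u), a g + b h⟩ = a ⟨F(u), g⟩ + b ⟨F(u), h⟩`. [folklore] -/
theorem nsGeneratorPairing_add_smul (ν : ℝ) {f : T3 → R3} (hf : Integrable f volume) (u : H3)
    (a b : ℝ) {g h : T3 → R3} (hg : Torus.IsSmooth g) (hh : Torus.IsSmooth h) :
    Torus.nsGeneratorPairing ν f u (fun x => a • g x + b • h x) =
      a * Torus.nsGeneratorPairing ν f u g + b * Torus.nsGeneratorPairing ν f u h := by
  have e : (fun x => a • g x + b • h x) = fun x => ∑ c : Bool,
      (fun c => bif c then a else b) c • (fun c : Bool => bif c then g else h) c x := by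
    funext x; simp
  rw [e, Torus.nsGeneratorPairing_sum_smul ν hf u Finset.univ (fun c : Bool => bif c then a else b)
    (g := fun c : Bool => bif c then g else h) (fun c _ => by cases c <;> assumption)]
  simp

/-- Transfer of an integrable mean-zero row along an a.e. equality. [folklore] -/
theorem integrable_and_integral_eq_zero_of_ae_eq {μ : Measure H3} {F G : H3 → ℝ}
    (hI : Integrable F μ) (h0 : ∫ u, F u ∂μ = 0) (hFG : F =ᵐ[μ] G) :
    Integrable G μ ∧ ∫ u, G u ∂μ = 0 :=
  ⟨hI.congr hFG, by rw [← integral_congr_ae hFG]; exact h0⟩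

/-- **RowΨ · `stub_smoothCylRow` — admissible laws annihilate every smooth function of
(energy, enstrophy) at level `N`.** For a probability law `μ` on `H` carried by level-`N` fields,
supported in `‖u‖ ≤ R`, stationary for Galerkin NS at `(ν, f)` against all polynomial cylindrical
band-limited observables (all degrees), and `Ψ : ℝ × ℝ → ℝ` of class `C¹` on an open set containing
`[0,∞)²`, the generator row of `u ↦ Ψ(‖P_N u‖², Z_N(u))` is integrable and vanishes:
`∫ [2 ∂₁Ψ(‖u‖², Z_N u) ⟨F(u), P_N u⟩ + 2 ∂₂Ψ(‖u‖², Z_N u) ⟨F(u), A P_N u⟩] dμ = 0`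
(`⟨F(u), w⟩ = Torus.nsGeneratorPairing ν f u w`, `A P_N u = Σ_{|k|≤N} Re(e_k 4π²|k|² û(k))`).
Proof: `exists_cylindricalTest` + `MomentParityMomentClosure.integral_nsGeneratorPairing_grad_eq_zero`
+ linearity of `⟨F(u), ·⟩`, see the module docstring.
[cite: FMRT2001, Ch. IV §1.2 (cylindrical test functionals), Ch. V App. B] -/
theorem stub_smoothCylRow :
    ∀ (ν : ℝ) (f : T3 → R3), Torus.IsSmooth f →
    ∀ (N : ℕ) (R : ℝ) (μ : Measure H3), IsProbabilityMeasure μ →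
      (∀ᵐ u ∂μ, IsLevel N u) → (∀ᵐ u ∂μ, ‖u‖ ≤ R) → (∀ d : ℕ, IsPolyStationary ν f N d μ) →
    ∀ (U : Set (ℝ × ℝ)) (Ψ : ℝ × ℝ → ℝ), IsOpen U → Set.Ici (0 : ℝ) ×ˢ Set.Ici (0 : ℝ) ⊆ U →
      ContDiffOn ℝ 1 Ψ U →
      Integrable (fun u : H3 =>
        2 * fderiv ℝ Ψ (‖u‖ ^ 2, 4 * Real.pi ^ 2 * ∑ k ∈ Torus.freqBall N, Torus.freqNormSq k *
              ‖UnitAddTorus.mFourierCoeff (EuclideanSpace.complexify ∘ (u.1 : T3 → R3)) k‖ ^ 2) (1, 0) *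
            Torus.nsGeneratorPairing ν f u (Torus.fourierTruncate N (u.1 : T3 → R3)) +
          2 * fderiv ℝ Ψ (‖u‖ ^ 2, 4 * Real.pi ^ 2 * ∑ k ∈ Torus.freqBall N, Torus.freqNormSq k *
              ‖UnitAddTorus.mFourierCoeff (EuclideanSpace.complexify ∘ (u.1 : T3 → R3)) k‖ ^ 2) (0, 1) *
            Torus.nsGeneratorPairing ν f u (Torus.realTrigPoly (Torus.freqBall N) fun k =>
              (((4 * Real.pi ^ 2 * Torus.freqNormSq k : ℝ)) : ℂ) •
                UnitAddTorus.mFourierCoeff (EuclideanSpace.complexify ∘ (u.1 : T3 → R3)) k)) μ ∧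
      ∫ u, (2 * fderiv ℝ Ψ (‖u‖ ^ 2, 4 * Real.pi ^ 2 * ∑ k ∈ Torus.freqBall N, Torus.freqNormSq k *
              ‖UnitAddTorus.mFourierCoeff (EuclideanSpace.complexify ∘ (u.1 : T3 → R3)) k‖ ^ 2) (1, 0) *
            Torus.nsGeneratorPairing ν f u (Torus.fourierTruncate N (u.1 : T3 → R3)) +
          2 * fderiv ℝ Ψ (‖u‖ ^ 2, 4 * Real.pi ^ 2 * ∑ k ∈ Torus.freqBall N, Torus.freqNormSq k *
              ‖UnitAddTorus.mFourierCoeff (EuclideanSpace.complexify ∘ (u.1 : T3 → R3)) k‖ ^ 2) (0, 1) *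
            Torus.nsGeneratorPairing ν f u (Torus.realTrigPoly (Torus.freqBall N) fun k =>
              (((4 * Real.pi ^ 2 * Torus.freqNormSq k : ℝ)) : ℂ) •
                UnitAddTorus.mFourierCoeff (EuclideanSpace.complexify ∘ (u.1 : T3 → R3)) k)) ∂μ = 0 := by
  intro ν f hf N R μ hP hL hB hS U Ψ hU hsub hΨ
  haveI := hP
  have hfi : Integrable f volume := hf.integrable
  -- the support radius is nonnegative (probability measure); the compact carrier `hμK`
  have hR : 0 ≤ R := by
    obtain ⟨u, hu⟩ := hB.exists
    exact (norm_nonneg u).trans hu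
  have hμK := hL.and hB
  -- the cylindrical test functional and its rows
  obtain ⟨Φ, hband, hgrad⟩ := exists_cylindricalTest N R hU hsub hΨ
  have hpoly : ∀ P : MvPolynomial (Fin Φ.m) ℝ,
      ∫ u, Torus.nsGeneratorPairing ν f u (polyGrad Φ.g P u) ∂μ = 0 := fun P =>
    (hS (P.totalDegree + 1) Φ.m Φ.g P hband le_rfl).2
  have h0 : ∫ u, Torus.nsGeneratorPairing ν f u (Φ.grad u) ∂μ = 0 :=
    MomentParityMomentClosure.integral_nsGeneratorPairing_grad_eq_zero ν hfi hR hμK Φ hpoly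
  have hI : Integrable (fun u => Torus.nsGeneratorPairing ν f u (Φ.grad u)) μ :=
    MomentParityMomentClosure.integrable_of_continuous_of_ae_mem
      (MomentParityMomentClosure.isCompact_levelBall N hR) hμK
      (Torus.continuous_nsGeneratorPairing_grad ν hfi Φ)
  -- identification of the row on the carrier
  refine integrable_and_integral_eq_zero_of_ae_eq hI h0 ?_
  filter_upwards [hL, hB] with u hu huR
  rw [hgrad u hu huR, nsGeneratorPairing_add_smul ν hfi u _ _ (Torus.isSmooth_fourierTruncate N _)
    (Torus.isSmooth_realTrigPoly _ _)]

end Summit.AnomalousDissipation.AnomalousDissipation.Theorems.MomentParityResolvedDissipation.CylRow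

end
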